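import Mathlib

/-!
# T5L2CauchySchwarz — Cauchy–Schwarz for the L² pairing of continuous forms

Kernel support (blind lane, Mathlib only) for route/T5-N1-hodge-p6.md §H5, the sentence «Without
the one-line hypothesis only Cauchy–Schwarz holds: |(ω_{ab}, ω_{cd})| ≤ ‖ω_{ab}‖‖ω_{cd}‖, and (N) ⟺
the two forms are not orthogonal», in the GLOBAL form of §H9 (T5L2Positivity): a form is a
continuous map `α : S → E` of a compact space into a complex inner product space, the pairing is
`(α, β) = ∫_S ⟪α s, β s⟫ dμ` for a finite measure `μ` (Voisin (5.1), p. 104 ll. 9–14), and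
`‖α‖² = ∫_S ‖α s‖² dμ`.

What is proved:
* `inner_toLp_eq_integral` / `norm_toLp_sq_eq_integral` — the pairing and the squared norm of the
  `L²` classes of continuous forms are the integrals above (Mathlib's `ContinuousMap.toLp` and the
  inner product space structure of `Lp E 2 μ`);
* `norm_integral_inner_le` — **Cauchy–Schwarz**: `‖∫ ⟪α, β⟫‖ ≤ √(∫ ‖α‖²) · √(∫ ‖β‖²)`;
* `norm_integral_inner_eq_iff` — equality holds for two non-zero forms iff they are proportional,
  when `μ` is positive on non-empty open sets (Mathlib `norm_inner_eq_norm_iff`, the `L²` class of a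
  continuous form determining the form);
* `integral_inner_ne_zero_of_smul` — the multiplicity-one reading of §H5 again: proportional
  non-zero forms are never orthogonal.

The identification of the pairing `∫_S α ∧ β̄` with `∫_S ⟪α, β⟫ dVol_S` is §H2 (T5HodgeStar /
T5TwoZeroPositivity); nothing automorphic enters.
-/

namespace Summit.Ventures.HodgeRepro2.T5L2CauchySchwarz

open MeasureTheory Measure Set

variable {S : Type*} [TopologicalSpace S] [CompactSpace S] [MeasurableSpace S]
  [BorelSpace S] (μ : Measure S) [IsFiniteMeasure μ]
  {E : Type*} [NormedAddCommGroup E] [InnerProductSpace ℂ E] [SecondCountableTopologyEither S E]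

/-- The `L²` class of a continuous form agrees with the form almost everywhere. -/
theorem toL2_ae_eq (α : C(S, E)) : (ContinuousMap.toLp (E := E) 2 μ ℂ α : S → E) =ᵐ[μ] α :=
  ContinuousMap.coeFn_toLp (p := 2) (𝕜 := ℂ) μ α

/-- The `L²` inner product of the classes of two continuous forms is the integral of the pointwise
inner product: the pairing `(α, β) = ∫_S ⟪α s, β s⟫ dμ`. -/
theorem inner_toLp_eq_integral (α β : C(S, E)) :
    inner ℂ (ContinuousMap.toLp (E := E) 2 μ ℂ α) (ContinuousMap.toLp (E := E) 2 μ ℂ β) =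
      ∫ s, inner ℂ (α s) (β s) ∂μ := by
  rw [MeasureTheory.L2.inner_def]
  refine integral_congr_ae ?_
  filter_upwards [toL2_ae_eq μ α, toL2_ae_eq μ β] with s hα hβ
  rw [hα, hβ]

/-- The self-pairing of a continuous form is the real number `∫_S ‖α s‖² dμ`. -/
theorem inner_toLp_self (α : C(S, E)) :
    inner ℂ (ContinuousMap.toLp (E := E) 2 μ ℂ α) (ContinuousMap.toLp (E := E) 2 μ ℂ α) =
      ((∫ s, ‖α s‖ ^ 2 ∂μ : ℝ) : ℂ) := by
  rw [inner_toLp_eq_integral, ← integral_complex_ofReal]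
  refine integral_congr_ae (Filter.Eventually.of_forall fun s => ?_)
  show inner ℂ (α s) (α s) = ((‖α s‖ ^ 2 : ℝ) : ℂ)
  rw [inner_self_eq_norm_sq_to_K, Complex.ofReal_pow]
  rfl

/-- The squared `L²` norm of the class of a continuous form is `∫_S ‖α s‖² dμ`. -/
theorem norm_toLp_sq_eq_integral (α : C(S, E)) :
    ‖ContinuousMap.toLp (E := E) 2 μ ℂ α‖ ^ 2 = ∫ s, ‖α s‖ ^ 2 ∂μ := by
  rw [← inner_self_eq_norm_sq (𝕜 := ℂ) (ContinuousMap.toLp (E := E) 2 μ ℂ α), inner_toLp_self,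
    RCLike.re_to_complex, Complex.ofReal_re]

/-- The `L²` norm of the class of a continuous form is `√(∫_S ‖α s‖² dμ)`. -/
theorem norm_toLp_eq_sqrt (α : C(S, E)) :
    ‖ContinuousMap.toLp (E := E) 2 μ ℂ α‖ = √(∫ s, ‖α s‖ ^ 2 ∂μ) := by
  rw [← norm_toLp_sq_eq_integral, Real.sqrt_sq (norm_nonneg _)]

/-- **Cauchy–Schwarz for the `L²` pairing of continuous forms**:
`‖∫_S ⟪α, β⟫ dμ‖ ≤ √(∫_S ‖α‖² dμ) · √(∫_S ‖β‖² dμ)`. -/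
theorem norm_integral_inner_le (α β : C(S, E)) :
    ‖∫ s, inner ℂ (α s) (β s) ∂μ‖ ≤ √(∫ s, ‖α s‖ ^ 2 ∂μ) * √(∫ s, ‖β s‖ ^ 2 ∂μ) := by
  rw [← inner_toLp_eq_integral, ← norm_toLp_eq_sqrt, ← norm_toLp_eq_sqrt]
  exact norm_inner_le_norm _ _

/-- The real form of Cauchy–Schwarz: `‖∫ ⟪α, β⟫‖² ≤ (∫ ‖α‖²) · (∫ ‖β‖²)`. -/
theorem norm_integral_inner_sq_le (α β : C(S, E)) :
    ‖∫ s, inner ℂ (α s) (β s) ∂μ‖ ^ 2 ≤ (∫ s, ‖α s‖ ^ 2 ∂μ) * ∫ s, ‖β s‖ ^ 2 ∂μ := by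
  have h := norm_integral_inner_le μ α β
  have hα : 0 ≤ ∫ s, ‖α s‖ ^ 2 ∂μ :=
    integral_nonneg fun s => sq_nonneg _
  have hβ : 0 ≤ ∫ s, ‖β s‖ ^ 2 ∂μ :=
    integral_nonneg fun s => sq_nonneg _
  calc ‖∫ s, inner ℂ (α s) (β s) ∂μ‖ ^ 2
      ≤ (√(∫ s, ‖α s‖ ^ 2 ∂μ) * √(∫ s, ‖β s‖ ^ 2 ∂μ)) ^ 2 :=
        pow_le_pow_left₀ (norm_nonneg _) h 2
    _ = (∫ s, ‖α s‖ ^ 2 ∂μ) * ∫ s, ‖β s‖ ^ 2 ∂μ := by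
        rw [mul_pow, Real.sq_sqrt hα, Real.sq_sqrt hβ]

section OpenPos

variable [IsOpenPosMeasure μ]

/-- For a measure positive on non-empty open sets, the `L²` class of a continuous form is zero iff
the form is zero. -/
theorem toL2_eq_zero_iff (α : C(S, E)) : (ContinuousMap.toLp (E := E) 2 μ ℂ α) = 0 ↔ α = 0 := by
  constructor
  · intro h
    have h1 : (α : S → E) =ᵐ[μ] 0 := by
      have h2 : (ContinuousMap.toLp (E := E) 2 μ ℂ α : S → E) =ᵐ[μ] 0 := by
        rw [h]; exact Lp.coeFn_zero E 2 μ
      exact (toL2_ae_eq μ α).symm.trans h2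
    have h3 : (α : S → E) = 0 := (α.continuous.ae_eq_iff_eq (μ := μ) continuous_const).1 h1
    ext s
    exact congrFun h3 s
  · rintro rfl
    exact (map_zero (ContinuousMap.toLp (E := E) 2 μ ℂ))

/-- For a measure positive on non-empty open sets, the `L²` classes of two continuous forms are
proportional iff the forms are. -/
theorem toL2_eq_smul_iff (α β : C(S, E)) (r : ℂ) :
    ContinuousMap.toLp (E := E) 2 μ ℂ β = r • ContinuousMap.toLp (E := E) 2 μ ℂ α ↔ β = r • α := by
  constructor
  · intro h
    have h1 : (β : S → E) =ᵐ[μ] r • (α : S → E) := by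
      have h2 : (ContinuousMap.toLp (E := E) 2 μ ℂ β : S → E) =ᵐ[μ]
          r • (ContinuousMap.toLp (E := E) 2 μ ℂ α : S → E) := by
        rw [h]; exact Lp.coeFn_smul r (ContinuousMap.toLp (E := E) 2 μ ℂ α)
      refine (toL2_ae_eq μ β).symm.trans (h2.trans ?_)
      filter_upwards [toL2_ae_eq μ α] with s hs
      simp only [Pi.smul_apply, hs]
    have h3 : (β : S → E) = r • (α : S → E) :=
      (β.continuous.ae_eq_iff_eq (μ := μ) (α.continuous.const_smul r)).1 h1
    ext s
    exact congrFun h3 s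
  · rintro rfl
    exact (map_smul (ContinuousMap.toLp (E := E) 2 μ ℂ) r α)

/-- **Equality in Cauchy–Schwarz**: for two non-zero continuous forms and a measure positive on
non-empty open sets, `‖∫ ⟪α, β⟫‖ = √(∫ ‖α‖²) · √(∫ ‖β‖²)` iff `β` is a non-zero multiple of `α`. -/
theorem norm_integral_inner_eq_iff (α β : C(S, E)) (hα : α ≠ 0) (hβ : β ≠ 0) :
    ‖∫ s, inner ℂ (α s) (β s) ∂μ‖ = √(∫ s, ‖α s‖ ^ 2 ∂μ) * √(∫ s, ‖β s‖ ^ 2 ∂μ) ↔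
      ∃ r : ℂ, r ≠ 0 ∧ β = r • α := by
  rw [← inner_toLp_eq_integral, ← norm_toLp_eq_sqrt, ← norm_toLp_eq_sqrt]
  have hα' : (ContinuousMap.toLp (E := E) 2 μ ℂ α) ≠ 0 := fun h => hα ((toL2_eq_zero_iff μ α).1 h)
  have hβ' : (ContinuousMap.toLp (E := E) 2 μ ℂ β) ≠ 0 := fun h => hβ ((toL2_eq_zero_iff μ β).1 h)
  rw [norm_inner_eq_norm_iff hα' hβ']
  constructor
  · rintro ⟨r, hr, h⟩
    exact ⟨r, hr, (toL2_eq_smul_iff μ α β r).1 h⟩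
  · rintro ⟨r, hr, h⟩
    exact ⟨r, hr, (toL2_eq_smul_iff μ α β r).2 h⟩

/-- Proportional non-zero forms are never orthogonal: `∫ ⟪α, r • α⟫ = r · ∫ ‖α‖² ≠ 0` for
`α ≠ 0`, `r ≠ 0` (the one-line case of §H5: `(ω, ω') ≠ 0 ⟺ ω ≠ 0 ∧ ω' ≠ 0`). -/
theorem integral_inner_ne_zero_of_smul (α : C(S, E)) (hα : α ≠ 0) {r : ℂ} (hr : r ≠ 0) :
    ∫ s, inner ℂ (α s) ((r • α) s) ∂μ ≠ 0 := by
  rw [← inner_toLp_eq_integral, (toL2_eq_smul_iff μ α (r • α) r).2 rfl, inner_smul_right]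
  refine mul_ne_zero hr ?_
  rw [inner_self_ne_zero]
  exact fun h => hα ((toL2_eq_zero_iff μ α).1 h)

end OpenPos

end Summit.Ventures.HodgeRepro2.T5L2CauchySchwarz
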